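import Summits.BirchSwinnertonDyer.BirchSwinnertonDyer.Theorems.KimAtThreeKolyvaginDeepLowerKatoStratumPartial
import Summits.BirchSwinnertonDyer.BirchSwinnertonDyer.Theorems.KimAtThreeKolyvaginDeepUpperRung
import HarnessLib

/-!
# SHALLOW levels on the Kato stratum at `t = 0`: every Kurihara number at every cyclic level is divisible by
# `3^{∂⁽⁰⁾ − ord₃ #Ш(3)}` GRANTED cell n1011's (a′) inputs; crux `ShallowEqDeepAtTorsionFree` (item
# stmt-BirchSwinnertonDyer-19077) there FOLLOWS from crux `DeepUpperAtThree` (19076) on the row; the T0-TAM law from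
# Kato's Tamagawa-exact reading — route W2 `KimAtThreeKolyvagin`, cell `bsd-addord`, seat kim3 gen 8

HONEST FRAMING. Theorems only (no definition, no named fact, no `sorry`); nothing asserted, nothing booked, no mark
moved; cruxes 19075/19076/19077 stay OPEN.  CONDITIONAL exactly as `KimAtThreeKolyvaginDeepLowerKatoStratumPartial.lean`:
[S24] Thm. 4.4 (1)(2) typed facts `hS24`/`hS24₂`, GZK, the Poitou–Tate families, ONE repaired dictionary port
`KatoKuriharaPortThreeAtWith₂ W 0 v₃ η D` (FLAG `K22-Thm3.13-PORT@3`, NOT in print at `3`); the last theorem also takes Kato's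
Tamagawa-exact reading `Kato2004.rankZero_padicValNat_sha_add_padicValNat_tamagawa_le_of_additive_potGood_of_imageContainsSL2`
(the BC5 fact of the route, PUB reading) by name.

WHAT.  On a row {`3`-adic tower onto, ADDITIVE at `3` with `3 ∤ c₃`, `E(ℚ₃)[3] = 0`, datum `D` at the conductor with
`3 ∤ c_D` + period transfer, `ord(δ̃) = 0`}, write `a = ∂⁽⁰⁾(δ̃)`, `s = ord₃ #Ш(E/ℚ)(3)`:
* `natCast_le_kuriharaPartialInfty_of_ports` — **`a − s ≤ ∂^{(∞)}(δ̃)` (the ALL-LEVELS infimum)**: no cyclic level, however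
  SHALLOW, carries a certificate of depth `≤ a − s` (Cor C-t at `t = 0` for every depth, prequel step (2), read through
  `coe_le_kuriharaDivIndex_iff`); the memo's Theorem A (iii) inequality `ord₃ δ_n ≥ e₀ + j₀` in kernel form on the stratum;
* `shallowEqDeep_conclusion_of_ports_of_deepUpper` — **crux 19077's conclusion `∂^{(∞)}_deep ≤ ∂^{(∞)}` for `D.f` FOLLOWS from
  crux 19076's conclusion on the row** (`s + d ≤ a` with `d = ∂^{(∞)}_deep` gives `d ≤ a − s ≤ ∂^{(∞)}`): on the `t = 0` Kato
  stratum the shallow = deep crux is not independent of the Kato-side crux, GRANTED the ports;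
* `tamagawa_le_kuriharaPartialInfty_of_ports_of_kato2004TamagawaExact` / `kuriharaDivisibleAt_tamagawa_of_ports_of_kato…` —
  with Kato's Tamagawa-exact reading (`s + v₃(∏ c_ℓ) ≤ a` on pot-good rows, gen 6 p411884): **`v₃(∏_ℓ c_ℓ) ≤ ∂^{(∞)}(δ̃)`**,
  i.e. every `δ̃_n` at every cyclic level is divisible by `3^{min(depth, v₃ ∏ c_ℓ)}` — the pre-registered T0-TAM reading
  rule of gen 7 (HOME/kim3/p7test/README.md: «NO unit at ANY cyclic level when 3 ∣ ∏ c_ℓ») as a kernel theorem GRANTED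
  the ports + Kato, no longer granted the cruxes (compare gen 7's
  `not_three_dvd_tamagawaProduct_of_unit_of_deepLower_of_shallowEqDeep_of_kato2004TamagawaExact`);
* `deepLower_newform_of_ports` — crux 19075's conclusion for EVERY newform `f` of `W` at an optimal datum's level (multiplicity
  one `IsNewformOf.unique`: `f = D.f`), the crux-shaped form of the prequel's `deepLower_optimal_of_ports`.
References: [Kim2025RefinedTNC] Thm 1.1; [Kim2022StructureSelmer] Thm. 1.9 (6), §1.5.1, Conj. 1.10; [Sakamoto2024] Thm. 4.4;
[Kato2004Asterisque] Thm. 14.5 (3), Prop. 14.16 (2); memo `run/shared/lean/pub/bsd-addord/kim3/KIM3-PROOF.md` §0 Thm A (iii), §16.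
-/

set_option autoImplicit false
-- the Theorems namespace of a single-conjunct summit repeats the summit name by design (D-0017)
set_option linter.dupNamespace false

noncomputable section

open scoped Classical NumberField ContRepresentation
open Function Field NumberField IsDedekindDomain IsDedekindDomain.HeightOneSpectrum WeierstrassCurve
  CongruenceSubgroup
  Literature.NumberTheory.EllipticCurves Literature.NumberTheory.EllipticCurves.ModularForms
  Literature.NumberTheory.EllipticCurves.Rank1Residual
  Literature.NumberTheory.GaloisRepresentations
  Literature.NumberTheory.GaloisRepresentations.DiscreteGaloisModule Literature.NumberTheory.GaloisCohomology
  Rat.HeightOneSpectrum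
  Summit.BirchSwinnertonDyer.Rank1Residual.GaloisImage
  Summit.BirchSwinnertonDyer.Rank1Residual.GaloisImage.Assembly
  Summit.BirchSwinnertonDyer.Rank1Residual.X4
  Summit.BirchSwinnertonDyer.BirchSwinnertonDyer.Theorems.KimAtThreeKolyvaginDeepUpperRung
  Summit.BirchSwinnertonDyer.BirchSwinnertonDyer.Theorems.KimAtThreeKolyvaginUnitLevelOneRungs
  Summit.BirchSwinnertonDyer.BirchSwinnertonDyer.Theorems.KimAtThreeKolyvaginCertificateDictionary
  Summit.BirchSwinnertonDyer.BirchSwinnertonDyer.Theorems.KimAtThreeKolyvaginDeepLowerOfCertificate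
  Summit.BirchSwinnertonDyer.BirchSwinnertonDyer.Theorems.KimAtThreeKolyvaginDeepLowerKatoStratum
  Summit.BirchSwinnertonDyer.BirchSwinnertonDyer.Theorems.KimAtThreeKolyvaginDeepLowerKatoStratumPartial

namespace Summit.BirchSwinnertonDyer.BirchSwinnertonDyer.Theorems.KimAtThreeKolyvaginDeepLowerKatoStratumShallow

/-- **`∂⁽⁰⁾ − ord₃ #Ш(3) ≤ ∂^{(∞)}(δ̃)` — ALL levels, shallow included — on the `t = 0` Kato stratum, GRANTED n1011's (a′)
inputs.** Row: tower onto, additive `3` with `3 ∤ c₃`, `E(ℚ₃)[3] = 0`, datum `D` at the conductor, `3 ∤ c_D`, period transfer,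
`ord(δ̃) = 0`, `∂⁽⁰⁾(δ̃) = a`. A cyclic level `n` with `ord δ̃_n < a − s` would carry an explicit `δ̃^{(k′)}_n(ψ) ≠ 0` with
`k′ ≤ a − s` and `n ∈ 𝒩_{k′}` (`coe_le_kuriharaDivIndex_iff`, `exists_kuriharaNumber_ne_zero_of_not_kuriharaDivisibleAt`); the
prequel's `exists_LOmega_padicValRat_le_of_towerSurj_with_depth_of_anyCertificate` at shallow depth `k′ − 1` and the reverse
bridge give `a ≤ s + k′ − 1`, a contradiction.  (Memo Thm A (iii): `ord₃ δ_n ≥ e₀ + j₀` at every level, kernel form on the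
stratum.) [cite: Kim2025RefinedTNC, Thm 1.1] [cite: Kim2022StructureSelmer, Thm. 1.9 (6), §1.5.1] [cite: Sakamoto2024, Thm. 4.4 (p. 926)] -/
theorem natCast_le_kuriharaPartialInfty_of_ports
    (hS24 : Sakamoto2024.kolyvaginSystems_freeRankOne_zmod_three_pow)
    (hS24₂ : Sakamoto2024.kolyvaginSystems_idealOfBasis_eq_fittingIdeal_zmod_three_pow)
    (hGZK : rank_eq_analyticRank_of_analyticRank_le_one)
    (W : WeierstrassCurve ℚ) [W.IsElliptic] [W.IsGloballyMinimal]
    (hadd : haveI : Fact (Nat.Prime 3) := ⟨Nat.prime_three⟩; Addv W 3)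
    (hc3 : ¬ 3 ∣ (W.baseChange ℚ_[3]).localTamagawaNumber ℤ_[3])
    (htower : ∀ m : ℕ, W.HasSurjectiveModNGaloisRep (3 ^ m : ℕ))
    (ht0 : Nat.card {Q : (W.baseChange ℚ_[3]).toAffine.Point // (3 : ℕ) • Q = 0} = 1)
    {N : ℕ} [NeZero N] (hN : N = W.conductorNorm ℤ) (D : ModularParametrizationData W N)
    (hcD : ¬ (3 : ℤ) ∣ D.maninConstant)
    (hper : ∃ u : ℚ, ‖(u : ℚ_[3])‖ = 1 ∧ W.realPeriodRat = u * plusPeriod D.f)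
    (inv : LocalInvariants ℚ 3) (hperf : inv.IsPerfect) (hsum : inv.SumLocalTermEqZero)
    (hcompl : inv.SelmerComplement)
    (inv' : ∀ k' : ℕ, LocalInvariants ℚ (3 ^ (k' + 1))) (hperf' : ∀ k', (inv' k').IsPerfect)
    (hsum' : ∀ k', (inv' k').SumLocalTermEqZero) (hcompl' : ∀ k', (inv' k').SelmerComplement)
    (hinj' : ∀ k', ∀ v : HeightOneSpectrum (𝓞 ℚ), Injective (inv' k' (Sum.inr v)))
    (v₃ : HeightOneSpectrum (𝓞 ℚ)) (hv₃ : ((3 : ℕ) : 𝓞 ℚ) ∈ v₃.asIdeal)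
    (η : (q : HeightOneSpectrum (𝓞 ℚ)) → (ZMod (Ideal.absNorm q.asIdeal))ˣ)
    (hη : ∀ q : HeightOneSpectrum (𝓞 ℚ), Subgroup.zpowers (η q) = ⊤)
    (hPort : KatoKuriharaPortThreeAtWith₂ W 0 v₃ η D)
    (hord : kuriharaVanishingOrder W 3 D.f = 0)
    {a : ℕ} (ha : kuriharaPartial W 3 D.f 0 = a) :
    ((a - padicValNat 3 (Nat.card (AddCommGroup.primaryComponent W.sha 3)) : ℕ) : ℕ∞) ≤
      kuriharaPartialInfty W 3 D.f := by
  haveI : Fact (Nat.Prime 3) := ⟨Nat.prime_three⟩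
  set s := padicValNat 3 (Nat.card (AddCommGroup.primaryComponent W.sha 3)) with hs
  have hirr : W.HasIrreducibleModPGaloisRep 3 :=
    hasIrreducibleModPGaloisRep_of_hasSurjectiveModNGaloisRep W 3 (by simpa using htower 1)
  have h0 : ratPlusSymbol D.f 0 ≠ 0 :=
    ratPlusSymbol_zero_ne_zero_of_kuriharaVanishingOrder_eq_zero W 3 D.f hord
  have hL : W.entireLFunction 1 ≠ 0 :=
    D.isNewformOf.entireLFunction_one_ne_zero_of_ratPlusSymbol_zero_ne_zero h0
  -- unfold the all-levels infimum: every cyclic level `n` must have `a − s ≤ ord δ̃_n`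
  refine le_iInf fun i => le_iInf fun n => le_iInf fun hn => le_iInf fun _ => ?_
  rw [coe_le_kuriharaDivIndex_iff]
  by_contra hcert
  obtain ⟨k', hk'1, hk'le, hk', ψ, hψ, hne⟩ :=
    exists_kuriharaNumber_ne_zero_of_not_kuriharaDivisibleAt W 3 D.f hcert
  haveI : NeZero n := ⟨hk'.ne_zero⟩
  have hn' : Kato.IsKolyvaginProduct W 3 (k' - 1 + 1) n := by rwa [Nat.sub_add_cancel hk'1]
  obtain ⟨q, hq, hle⟩ :=
    exists_LOmega_padicValRat_le_of_towerSurj_with_depth_of_anyCertificate hS24 hS24₂ hGZK W hadd hc3 htower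
      ht0 hL D hcD hper inv hperf hsum hcompl inv' hperf' hsum' hcompl' hinj' v₃ hv₃ η hη hPort (k' - 1) n hn'
      (fun ℓ _ hℓ => hn.2 ℓ hℓ) (fun ℓ hℓ hℓN => (hk'.2 ℓ hℓ).not_dvd_conductorNorm (hN ▸ hℓN)) (j := k')
      (by omega) ψ hψ hne
  have hle' : padicValRat 3 q ≤ ((s + (k' - 1) : ℕ) : ℤ) := by push_cast at hle ⊢; linarith
  have h' := kuriharaPartial_zero_le_natCast_of_padicValRat_le W 3 D.f (by norm_num) hirr D.isNewformOf h0
    hper hq hle'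
  rw [ha] at h'
  have h'' : a ≤ s + (k' - 1) := by exact_mod_cast h'
  omega

/-- **On the `t = 0` Kato stratum, crux 19077's conclusion FOLLOWS from crux 19076's conclusion on the row, GRANTED
n1011's (a′) inputs.**  If `∂^{(∞)}_deep(δ̃) = d` with `ord₃ #Ш(3) + d ≤ ∂⁽⁰⁾(δ̃)` (the conclusion of `DeepUpperAtThree` for
`(W, D.f)`), then `∂^{(∞)}_deep(δ̃) ≤ ∂^{(∞)}(δ̃)` (the conclusion of `ShallowEqDeepAtTorsionFree` for `(W, D.f)`): indeed
`d ≤ ∂⁽⁰⁾ − ord₃ #Ш(3) ≤ ∂^{(∞)}` by `natCast_le_kuriharaPartialInfty_of_ports`.  So on this stratum the shallow = deep crux is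
not independent of the Kato-side crux. [cite: Kim2025RefinedTNC, Thm 1.1] [cite: MazurRubin2004, Thm. 5.2.12 (i)]
[cite: Sakamoto2024, Thm. 4.4 (p. 926)] -/
theorem shallowEqDeep_conclusion_of_ports_of_deepUpper
    (hS24 : Sakamoto2024.kolyvaginSystems_freeRankOne_zmod_three_pow)
    (hS24₂ : Sakamoto2024.kolyvaginSystems_idealOfBasis_eq_fittingIdeal_zmod_three_pow)
    (hGZK : rank_eq_analyticRank_of_analyticRank_le_one)
    (W : WeierstrassCurve ℚ) [W.IsElliptic] [W.IsGloballyMinimal]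
    (hadd : haveI : Fact (Nat.Prime 3) := ⟨Nat.prime_three⟩; Addv W 3)
    (hc3 : ¬ 3 ∣ (W.baseChange ℚ_[3]).localTamagawaNumber ℤ_[3])
    (htower : ∀ m : ℕ, W.HasSurjectiveModNGaloisRep (3 ^ m : ℕ))
    (ht0 : Nat.card {Q : (W.baseChange ℚ_[3]).toAffine.Point // (3 : ℕ) • Q = 0} = 1)
    {N : ℕ} [NeZero N] (hN : N = W.conductorNorm ℤ) (D : ModularParametrizationData W N)
    (hcD : ¬ (3 : ℤ) ∣ D.maninConstant)
    (hper : ∃ u : ℚ, ‖(u : ℚ_[3])‖ = 1 ∧ W.realPeriodRat = u * plusPeriod D.f)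
    (inv : LocalInvariants ℚ 3) (hperf : inv.IsPerfect) (hsum : inv.SumLocalTermEqZero)
    (hcompl : inv.SelmerComplement)
    (inv' : ∀ k' : ℕ, LocalInvariants ℚ (3 ^ (k' + 1))) (hperf' : ∀ k', (inv' k').IsPerfect)
    (hsum' : ∀ k', (inv' k').SumLocalTermEqZero) (hcompl' : ∀ k', (inv' k').SelmerComplement)
    (hinj' : ∀ k', ∀ v : HeightOneSpectrum (𝓞 ℚ), Injective (inv' k' (Sum.inr v)))
    (v₃ : HeightOneSpectrum (𝓞 ℚ)) (hv₃ : ((3 : ℕ) : 𝓞 ℚ) ∈ v₃.asIdeal)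
    (η : (q : HeightOneSpectrum (𝓞 ℚ)) → (ZMod (Ideal.absNorm q.asIdeal))ˣ)
    (hη : ∀ q : HeightOneSpectrum (𝓞 ℚ), Subgroup.zpowers (η q) = ⊤)
    (hPort : KatoKuriharaPortThreeAtWith₂ W 0 v₃ η D)
    (hord : kuriharaVanishingOrder W 3 D.f = 0)
    (hU : ∃ d : ℕ, kuriharaPartialDeepInfty W 3 D.f = d ∧
      ((padicValNat 3 (Nat.card (AddCommGroup.primaryComponent W.sha 3)) + d : ℕ) : ℕ∞) ≤
        kuriharaPartial W 3 D.f 0) :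
    kuriharaPartialDeepInfty W 3 D.f ≤ kuriharaPartialInfty W 3 D.f := by
  haveI : Fact (Nat.Prime 3) := ⟨Nat.prime_three⟩
  set s := padicValNat 3 (Nat.card (AddCommGroup.primaryComponent W.sha 3)) with hs
  have hfin0 : kuriharaPartial W 3 D.f 0 < ⊤ := by
    rw [kuriharaPartial_zero]
    exact kuriharaDivIndex_one_lt_top_of_kuriharaVanishingOrder_eq_zero W 3 D.f hord
  obtain ⟨a, ha⟩ : ∃ a : ℕ, kuriharaPartial W 3 D.f 0 = a :=
    (ENat.ne_top_iff_exists.mp hfin0.ne).imp fun a h => h.symm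
  obtain ⟨d, hd, hle⟩ := hU
  rw [ha] at hle
  have hle' : s + d ≤ a := by exact_mod_cast hle
  rw [hd]
  refine le_trans ?_ (natCast_le_kuriharaPartialInfty_of_ports hS24 hS24₂ hGZK W hadd hc3 htower ht0 hN D hcD hper
    inv hperf hsum hcompl inv' hperf' hsum' hcompl' hinj' v₃ hv₃ η hη hPort hord ha)
  exact_mod_cast (show d ≤ a - s by omega)

/-- **The T0-TAM law as a kernel theorem GRANTED the ports + Kato's Tamagawa-exact reading: `v₃(∏_ℓ c_ℓ) ≤ ∂^{(∞)}(δ̃)`** on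
the `t = 0` Kato stratum restricted to POTENTIALLY GOOD reduction (`0 ≤ v₃(j)`, Kato's printed stratum): Kato gives
`ord₃ #Ш(3) + v₃(∏ c_ℓ) ≤ ∂⁽⁰⁾` (`sha_add_tamagawa_le_kuriharaPartial_zero_of_kato2004TamagawaExact`, gen 6), the ports give
`∂⁽⁰⁾ − ord₃ #Ш(3) ≤ ∂^{(∞)}`.  Reading: NO Kurihara number at ANY cyclic level is a unit when `3 ∣ ∏ c_ℓ`; more generally
`δ̃_n ≡ 0 (mod 3^{min(depth(n), v₃ ∏ c_ℓ)})` (next theorem) — gen 7's pre-registered T0-TAM reading rule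
(HOME/kim3/p7test/README.md), conditional on the ports and Kato instead of on cruxes 19075 ∧ 19077.
[cite: Kato2004Asterisque, Thm. 14.5 (3) (p. 236), Prop. 14.16 (2) (p. 244)] [cite: Kim2022StructureSelmer, Conj. 1.10 (PDF p. 8)]
[cite: Sakamoto2024, Thm. 4.4 (p. 926)] -/
theorem tamagawa_le_kuriharaPartialInfty_of_ports_of_kato2004TamagawaExact
    (hKato : Kato2004.rankZero_padicValNat_sha_add_padicValNat_tamagawa_le_of_additive_potGood_of_imageContainsSL2)
    (hS24 : Sakamoto2024.kolyvaginSystems_freeRankOne_zmod_three_pow)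
    (hS24₂ : Sakamoto2024.kolyvaginSystems_idealOfBasis_eq_fittingIdeal_zmod_three_pow)
    (hGZK : rank_eq_analyticRank_of_analyticRank_le_one)
    (W : WeierstrassCurve ℚ) [W.IsElliptic] [W.IsGloballyMinimal]
    (hadd : haveI : Fact (Nat.Prime 3) := ⟨Nat.prime_three⟩; Addv W 3)
    (hpot : 0 ≤ padicValRat 3 W.j)
    (hc3 : ¬ 3 ∣ (W.baseChange ℚ_[3]).localTamagawaNumber ℤ_[3])
    (htower : ∀ m : ℕ, W.HasSurjectiveModNGaloisRep (3 ^ m : ℕ))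
    (ht0 : Nat.card {Q : (W.baseChange ℚ_[3]).toAffine.Point // (3 : ℕ) • Q = 0} = 1)
    {N : ℕ} [NeZero N] (hN : N = W.conductorNorm ℤ) (D : ModularParametrizationData W N)
    (hcD : ¬ (3 : ℤ) ∣ D.maninConstant)
    (hper : ∃ u : ℚ, ‖(u : ℚ_[3])‖ = 1 ∧ W.realPeriodRat = u * plusPeriod D.f)
    (inv : LocalInvariants ℚ 3) (hperf : inv.IsPerfect) (hsum : inv.SumLocalTermEqZero)
    (hcompl : inv.SelmerComplement)
    (inv' : ∀ k' : ℕ, LocalInvariants ℚ (3 ^ (k' + 1))) (hperf' : ∀ k', (inv' k').IsPerfect)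
    (hsum' : ∀ k', (inv' k').SumLocalTermEqZero) (hcompl' : ∀ k', (inv' k').SelmerComplement)
    (hinj' : ∀ k', ∀ v : HeightOneSpectrum (𝓞 ℚ), Injective (inv' k' (Sum.inr v)))
    (v₃ : HeightOneSpectrum (𝓞 ℚ)) (hv₃ : ((3 : ℕ) : 𝓞 ℚ) ∈ v₃.asIdeal)
    (η : (q : HeightOneSpectrum (𝓞 ℚ)) → (ZMod (Ideal.absNorm q.asIdeal))ˣ)
    (hη : ∀ q : HeightOneSpectrum (𝓞 ℚ), Subgroup.zpowers (η q) = ⊤)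
    (hPort : KatoKuriharaPortThreeAtWith₂ W 0 v₃ η D)
    (hord : kuriharaVanishingOrder W 3 D.f = 0) :
    ((padicValNat 3 W.tamagawaProduct : ℕ) : ℕ∞) ≤ kuriharaPartialInfty W 3 D.f := by
  haveI : Fact (Nat.Prime 3) := ⟨Nat.prime_three⟩
  set s := padicValNat 3 (Nat.card (AddCommGroup.primaryComponent W.sha 3)) with hs
  have h0 : ratPlusSymbol D.f 0 ≠ 0 :=
    ratPlusSymbol_zero_ne_zero_of_kuriharaVanishingOrder_eq_zero W 3 D.f hord
  have hL : W.entireLFunction 1 ≠ 0 :=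
    D.isNewformOf.entireLFunction_one_ne_zero_of_ratPlusSymbol_zero_ne_zero h0
  have hr : W.analyticRank = 0 := analyticRank_eq_zero_of_entireLFunction_one_ne_zero W hL
  have hfin : Finite W.sha := (hGZK W (by rw [hr]; exact zero_le_one)).2
  have hfin0 : kuriharaPartial W 3 D.f 0 < ⊤ := by
    rw [kuriharaPartial_zero]
    exact kuriharaDivIndex_one_lt_top_of_kuriharaVanishingOrder_eq_zero W 3 D.f hord
  obtain ⟨a, ha⟩ : ∃ a : ℕ, kuriharaPartial W 3 D.f 0 = a :=
    (ENat.ne_top_iff_exists.mp hfin0.ne).imp fun a h => h.symm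
  have hKa := sha_add_tamagawa_le_kuriharaPartial_zero_of_kato2004TamagawaExact hKato W htower hfin D.f D.isNewformOf
    hord hadd.1 hadd.2 hpot hper
  rw [ha] at hKa
  have hKa' : s + padicValNat 3 W.tamagawaProduct ≤ a := by exact_mod_cast hKa
  refine le_trans ?_ (natCast_le_kuriharaPartialInfty_of_ports hS24 hS24₂ hGZK W hadd hc3 htower ht0 hN D hcD hper
    inv hperf hsum hcompl inv' hperf' hsum' hcompl' hinj' v₃ hv₃ η hη hPort hord ha)
  exact_mod_cast (show padicValNat 3 W.tamagawaProduct ≤ a - s by omega)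

/-- **The same in certificate currency (the T0-TAM reading rule, level by level)**: on the pot-good `t = 0` Kato stratum,
GRANTED the ports + Kato's Tamagawa-exact reading, EVERY cyclic Kolyvagin level `n` has `δ̃_n ∈ 3^{v₃(∏ c_ℓ)} ℤ₃/I_n`
(`KuriharaDivisibleAt … n (v₃ ∏ c_ℓ)`): for every `k ≤ v₃(∏ c_ℓ)` with `n ∈ 𝒩_k(E,3)` and all surjective discrete
logarithms `ψ`, `kuriharaNumber D.f (3^k) n ψ = 0`.  In particular `3 ∣ ∏ c_ℓ` forbids a unit Kurihara number at any cyclic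
level. [cite: Kato2004Asterisque, Thm. 14.5 (3) (p. 236)] [cite: Kim2022StructureSelmer, §1.5.1 and Conj. 1.10 (PDF p. 8)] -/
theorem kuriharaDivisibleAt_tamagawa_of_ports_of_kato2004TamagawaExact
    (hKato : Kato2004.rankZero_padicValNat_sha_add_padicValNat_tamagawa_le_of_additive_potGood_of_imageContainsSL2)
    (hS24 : Sakamoto2024.kolyvaginSystems_freeRankOne_zmod_three_pow)
    (hS24₂ : Sakamoto2024.kolyvaginSystems_idealOfBasis_eq_fittingIdeal_zmod_three_pow)
    (hGZK : rank_eq_analyticRank_of_analyticRank_le_one)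
    (W : WeierstrassCurve ℚ) [W.IsElliptic] [W.IsGloballyMinimal]
    (hadd : haveI : Fact (Nat.Prime 3) := ⟨Nat.prime_three⟩; Addv W 3)
    (hpot : 0 ≤ padicValRat 3 W.j)
    (hc3 : ¬ 3 ∣ (W.baseChange ℚ_[3]).localTamagawaNumber ℤ_[3])
    (htower : ∀ m : ℕ, W.HasSurjectiveModNGaloisRep (3 ^ m : ℕ))
    (ht0 : Nat.card {Q : (W.baseChange ℚ_[3]).toAffine.Point // (3 : ℕ) • Q = 0} = 1)
    {N : ℕ} [NeZero N] (hN : N = W.conductorNorm ℤ) (D : ModularParametrizationData W N)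
    (hcD : ¬ (3 : ℤ) ∣ D.maninConstant)
    (hper : ∃ u : ℚ, ‖(u : ℚ_[3])‖ = 1 ∧ W.realPeriodRat = u * plusPeriod D.f)
    (inv : LocalInvariants ℚ 3) (hperf : inv.IsPerfect) (hsum : inv.SumLocalTermEqZero)
    (hcompl : inv.SelmerComplement)
    (inv' : ∀ k' : ℕ, LocalInvariants ℚ (3 ^ (k' + 1))) (hperf' : ∀ k', (inv' k').IsPerfect)
    (hsum' : ∀ k', (inv' k').SumLocalTermEqZero) (hcompl' : ∀ k', (inv' k').SelmerComplement)
    (hinj' : ∀ k', ∀ v : HeightOneSpectrum (𝓞 ℚ), Injective (inv' k' (Sum.inr v)))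
    (v₃ : HeightOneSpectrum (𝓞 ℚ)) (hv₃ : ((3 : ℕ) : 𝓞 ℚ) ∈ v₃.asIdeal)
    (η : (q : HeightOneSpectrum (𝓞 ℚ)) → (ZMod (Ideal.absNorm q.asIdeal))ˣ)
    (hη : ∀ q : HeightOneSpectrum (𝓞 ℚ), Subgroup.zpowers (η q) = ⊤)
    (hPort : KatoKuriharaPortThreeAtWith₂ W 0 v₃ η D)
    (hord : kuriharaVanishingOrder W 3 D.f = 0)
    {n : ℕ} (hn : IsCyclicKolyvaginLevel W 3 n) :
    KuriharaDivisibleAt W 3 D.f n (padicValNat 3 W.tamagawaProduct) := by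
  rw [← coe_le_kuriharaDivIndex_iff]
  refine le_trans (tamagawa_le_kuriharaPartialInfty_of_ports_of_kato2004TamagawaExact hKato hS24 hS24₂ hGZK W hadd hpot
    hc3 htower ht0 hN D hcD hper inv hperf hsum hcompl inv' hperf' hsum' hcompl' hinj' v₃ hv₃ η hη hPort hord) ?_
  exact le_trans (kuriharaPartialInfty_le W 3 D.f n.primeFactors.card) (kuriharaPartial_le W 3 D.f hn rfl)

/-! ### Crux-shaped corollary: any newform `f` of `W` at the conductor (multiplicity one) -/

/-- **Crux 19075's conclusion for EVERY newform `f` of `W` at the level of an optimal datum** (the crux binds an arbitrary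
`f` with `IsNewformOf W f`; by multiplicity one `IsNewformOf.unique` such an `f` at the datum's level IS `D.f`): GRANTED
n1011's (a′) inputs at `t = 0`, on the stratum {tower onto, additive `3`, `3 ∤ c₃`, `E(ℚ₃)[3] = 0`} with an OPTIMAL datum `D`
at the conductor, `3 ∤ c_D`, and the port keyed at `D`: for every `f ∈ S₂(Γ₀(N))` with `IsNewformOf W f` and `ord(δ̃_f) = 0`,
`∂^{(∞)}_deep(δ̃_f) = d ∈ ℕ` and `∂⁽⁰⁾(δ̃_f) ≤ ord₃ #Ш(E/ℚ)(3) + d`.  (The crux's `3`-integrality binder is not needed: it is a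
theorem on tower rows and unused by the road.) [cite: Kim2025RefinedTNC, Thm 1.1] [cite: Sakamoto2024, Thm. 4.4 (p. 926)]
[cite: Carayol1986] -/
theorem deepLower_newform_of_ports
    (hS24 : Sakamoto2024.kolyvaginSystems_freeRankOne_zmod_three_pow)
    (hS24₂ : Sakamoto2024.kolyvaginSystems_idealOfBasis_eq_fittingIdeal_zmod_three_pow)
    (hGZK : rank_eq_analyticRank_of_analyticRank_le_one)
    (W : WeierstrassCurve ℚ) [W.IsElliptic] [W.IsGloballyMinimal]
    (hadd : haveI : Fact (Nat.Prime 3) := ⟨Nat.prime_three⟩; Addv W 3)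
    (hc3 : ¬ 3 ∣ (W.baseChange ℚ_[3]).localTamagawaNumber ℤ_[3])
    (htower : ∀ m : ℕ, W.HasSurjectiveModNGaloisRep (3 ^ m : ℕ))
    (ht0 : Nat.card {Q : (W.baseChange ℚ_[3]).toAffine.Point // (3 : ℕ) • Q = 0} = 1)
    {N : ℕ} [NeZero N] (hN : N = W.conductorNorm ℤ) (D : ModularParametrizationData W N)
    (hopt : ∀ z ∈ D.L.lattice, ∃ w ∈ periodLattice D.f, z = D.c * w)
    (hcD : ¬ (3 : ℤ) ∣ D.maninConstant)
    (inv : LocalInvariants ℚ 3) (hperf : inv.IsPerfect) (hsum : inv.SumLocalTermEqZero)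
    (hcompl : inv.SelmerComplement)
    (inv' : ∀ k' : ℕ, LocalInvariants ℚ (3 ^ (k' + 1))) (hperf' : ∀ k', (inv' k').IsPerfect)
    (hsum' : ∀ k', (inv' k').SumLocalTermEqZero) (hcompl' : ∀ k', (inv' k').SelmerComplement)
    (hinj' : ∀ k', ∀ v : HeightOneSpectrum (𝓞 ℚ), Injective (inv' k' (Sum.inr v)))
    (v₃ : HeightOneSpectrum (𝓞 ℚ)) (hv₃ : ((3 : ℕ) : 𝓞 ℚ) ∈ v₃.asIdeal)
    (η : (q : HeightOneSpectrum (𝓞 ℚ)) → (ZMod (Ideal.absNorm q.asIdeal))ˣ)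
    (hη : ∀ q : HeightOneSpectrum (𝓞 ℚ), Subgroup.zpowers (η q) = ⊤)
    (hPort : KatoKuriharaPortThreeAtWith₂ W 0 v₃ η D)
    (f : CuspForm (Gamma0 N) 2) (hf : IsNewformOf W f) (hord : kuriharaVanishingOrder W 3 f = 0) :
    ∃ d : ℕ, kuriharaPartialDeepInfty W 3 f = d ∧
      kuriharaPartial W 3 f 0 ≤
        ((padicValNat 3 (Nat.card (AddCommGroup.primaryComponent W.sha 3)) + d : ℕ) : ℕ∞) := by
  obtain rfl : f = D.f := hf.unique D.isNewformOf
  exact deepLower_optimal_of_ports hS24 hS24₂ hGZK W hadd hc3 htower ht0 hN D hopt hcD inv hperf hsum hcompl inv'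
    hperf' hsum' hcompl' hinj' v₃ hv₃ η hη hPort hord

end Summit.BirchSwinnertonDyer.BirchSwinnertonDyer.Theorems.KimAtThreeKolyvaginDeepLowerKatoStratumShallow

end
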